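import Literature.Probability.LatticeModels.ConformalCovariance
import Mathlib.Analysis.SpecialFunctions.Pow.Real
import HarnessLib

/-!
# Crux `LinkingParityCircles.SpinRatioMoebius` (stmt-CriticalPhenomena-4530), line `registered` —
# stub `stub_ratioOfCovariantFamily`: pairing quotients of a Möbius covariant family are Möbius INVARIANT

For a continuum family `S : CorrFamily 3` of `n`-point functions on `ℝ³` that is Möbius covariant with
scaling dimension `Δ` (`IsMoebiusCovariant Δ S`: invariance under translations and linear isometries,
scale covariance `S n (c x) = c^{-nΔ} S n x`, and covariance `S n (ι x) = (∏ᵢ ‖xᵢ‖^{2Δ}) S n x` under the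
unit inversion `ι x = x/‖x‖²` at configurations avoiding the origin), the PAIRING QUOTIENT
`P_m(x) = S_{2m}(x₁, …, x_{2m}) / ∏_{j<m} S_2(x_j, x_{j+m})` is Möbius INVARIANT: translations and linear
isometries carry no factor, under the dilation by `c > 0` numerator and denominator both pick up
`c^{-2mΔ} = (c^{-2Δ})^m`, and under the unit inversion both pick up
`∏ᵢ ‖xᵢ‖^{2Δ} = ∏_{j<m} ‖x_j‖^{2Δ} ‖x_{j+m}‖^{2Δ}`, because the pairing `(j, j+m)` covers every index
exactly once. Since `a / 0 = 0` in Lean and the common factors are nonzero, `(w a)/(w b) = a/b`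
(`mul_div_mul_left`) needs no non-vanishing hypothesis on `S`.

Pure algebra from the definitions of `Literature.Probability.LatticeModels.ConformalCovariance`
(Di Francesco–Mathieu–Sénéchal, *Conformal Field Theory* (Springer 1997), §4.3.1, eq. (4.62)).
-/

noncomputable section

namespace Summit.CriticalPhenomena.Ising3DConformalLimit.Cruxes.SpinRatioMoebius.Birth

open Literature.Probability.LatticeModels

/-- Two-point instance of translation invariance: `S₂(a + v, b + v) = S₂(a, b)`. [folklore] -/
theorem covQuot_twoPoint_translate {S : CorrFamily 3} (htr : IsTranslationInvariant S)
    (v a b : EuclideanSpace ℝ (Fin 3)) : S 2 ![a + v, b + v] = S 2 ![a, b] := by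
  have hcfg : (![a + v, b + v] : Fin 2 → EuclideanSpace ℝ (Fin 3)) =
      fun i => (![a, b] : Fin 2 → EuclideanSpace ℝ (Fin 3)) i + v := by
    funext i; fin_cases i <;> rfl
  rw [hcfg]
  exact htr 2 v _

/-- Two-point instance of `O(3)` invariance: `S₂(A a, A b) = S₂(a, b)`. [folklore] -/
theorem covQuot_twoPoint_rotate {S : CorrFamily 3} (hrot : IsRotationInvariant S)
    (A : EuclideanSpace ℝ (Fin 3) ≃ₗᵢ[ℝ] EuclideanSpace ℝ (Fin 3)) (a b : EuclideanSpace ℝ (Fin 3)) :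
    S 2 ![A a, A b] = S 2 ![a, b] := by
  have hcfg : (![A a, A b] : Fin 2 → EuclideanSpace ℝ (Fin 3)) =
      fun i => A ((![a, b] : Fin 2 → EuclideanSpace ℝ (Fin 3)) i) := by
    funext i; fin_cases i <;> rfl
  rw [hcfg]
  exact hrot 2 A _

/-- Two-point instance of scale covariance: `S₂(c a, c b) = c^{-2Δ} S₂(a, b)` for `c > 0`. [folklore] -/
theorem covQuot_twoPoint_smul {Δ : ℝ} {S : CorrFamily 3} (hsc : IsScaleCovariant Δ S) {c : ℝ}
    (hc : 0 < c) (a b : EuclideanSpace ℝ (Fin 3)) :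
    S 2 ![c • a, c • b] = c ^ (-(2 : ℝ) * Δ) * S 2 ![a, b] := by
  have hcfg : (![c • a, c • b] : Fin 2 → EuclideanSpace ℝ (Fin 3)) =
      fun i => c • (![a, b] : Fin 2 → EuclideanSpace ℝ (Fin 3)) i := by
    funext i; fin_cases i <;> rfl
  rw [hcfg, hsc 2 c hc _]
  norm_num

/-- Two-point instance of inversion covariance: `S₂(ι a, ι b) = ‖a‖^{2Δ} ‖b‖^{2Δ} S₂(a, b)` for
`a, b ≠ 0`, `ι` the unit inversion. [folklore] -/
theorem covQuot_twoPoint_invert {Δ : ℝ} {S : CorrFamily 3} (hinv : IsInversionCovariant Δ S)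
    {a b : EuclideanSpace ℝ (Fin 3)} (ha : a ≠ 0) (hb : b ≠ 0) :
    S 2 ![EuclideanGeometry.inversion 0 1 a, EuclideanGeometry.inversion 0 1 b] =
      ‖a‖ ^ (2 * Δ) * ‖b‖ ^ (2 * Δ) * S 2 ![a, b] := by
  have hcfg : (![EuclideanGeometry.inversion 0 1 a, EuclideanGeometry.inversion 0 1 b] :
      Fin 2 → EuclideanSpace ℝ (Fin 3)) =
      fun i => EuclideanGeometry.inversion 0 1 ((![a, b] : Fin 2 → EuclideanSpace ℝ (Fin 3)) i) := by
    funext i; fin_cases i <;> rfl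
  have h := hinv 2 ![a, b] (fun i => by fin_cases i <;> assumption)
  rw [Fin.prod_univ_two] at h
  rw [hcfg, h]
  rfl

/-- The scale factors of the `m` two-point denominators multiply to that of the `2m`-point numerator:
`(c^{-2Δ})^m = c^{-(m+m)Δ}`. [folklore] -/
theorem covQuot_rpow_pow {c : ℝ} (hc : 0 < c) (Δ : ℝ) (m : ℕ) :
    (c ^ (-(2 : ℝ) * Δ)) ^ m = c ^ (-((m + m : ℕ) : ℝ) * Δ) := by
  rw [← Real.rpow_natCast, ← Real.rpow_mul hc.le]
  congr 1
  push_cast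
  ring

/-- The product of the paired norm weights is the product of all norm weights (the pairing `(j, j+m)`
covers every index once). [folklore] -/
theorem prod_pair_norms' (m : ℕ) (Δ : ℝ) (x : Fin (m + m) → EuclideanSpace ℝ (Fin 3)) :
    (∏ j : Fin m, ‖x (Fin.castAdd m j)‖ ^ (2 * Δ) * ‖x (Fin.natAdd m j)‖ ^ (2 * Δ)) =
      ∏ i : Fin (m + m), ‖x i‖ ^ (2 * Δ) := by
  rw [Fin.prod_univ_add, Finset.prod_mul_distrib]

/-- **Stub `stub_ratioOfCovariantFamily` (pairing quotients of a Möbius covariant family are Möbius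
INVARIANT).** For `S : CorrFamily 3` Möbius covariant with weight `Δ`, the quotient
`S_{2m}(x)/∏_j S_2(x_j, x_{j+m})` is invariant under translations, linear isometries, dilations `c > 0`
and (at configurations avoiding `0`) the unit inversion: the scale factor `c^{-2mΔ}` and the inversion
weight `∏_i ‖x_i‖^{2Δ}` of the numerator are exactly those of the denominator (the pairing covers every
index once; division by zero is `0` on both sides).
[cite: FrancescoMathieuSenechal1997, §4.3.1 eq. (4.62)] -/
theorem stub_ratioOfCovariantFamily :
    ∀ (Δ : ℝ) (S : Literature.Probability.LatticeModels.CorrFamily 3), Literature.Probability.LatticeModels.IsMoebiusCovariant Δ S → ∀ (m : ℕ) (x : Fin (m + m) → EuclideanSpace ℝ (Fin 3)), (∀ v : EuclideanSpace ℝ (Fin 3), S (m + m) (fun i => x i + v) / (∏ j : Fin m, S 2 ![x (Fin.castAdd m j) + v, x (Fin.natAdd m j) + v]) = S (m + m) x / ∏ j : Fin m, S 2 ![x (Fin.castAdd m j), x (Fin.natAdd m j)]) ∧ (∀ A : EuclideanSpace ℝ (Fin 3) ≃ₗᵢ[ℝ] EuclideanSpace ℝ (Fin 3), S (m + m) (fun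 i => A (x i)) / (∏ j : Fin m, S 2 ![A (x (Fin.castAdd m j)), A (x (Fin.natAdd m j))]) = S (m + m) x / ∏ j : Fin m, S 2 ![x (Fin.castAdd m j), x (Fin.natAdd m j)]) ∧ (∀ c : ℝ, 0 < c → S (m + m) (fun i => c • x i) / (∏ j : Fin m, S 2 ![c • x (Fin.castAdd m j), c • x (Fin.natAdd m j)]) = S (m + m) x / ∏ j : Fin m, S 2 ![x (Fin.castAdd m j), x (Fin.natAdd m j)]) ∧ ((∀ i, x i ≠ 0) → S (m + m) (fun i => EuclideanGeometry.inversion 0 1 (x i)) / (∏ j : Fin m, S 2 ![EuclideanGeometry.inversion 0 1 (x (Fin.castAdd m j)), EuclideanGeometry.inversion 0 1 (x (Fin.natAdd m j))]) = S (m + m) x / ∏ j : Fin m, S 2 ![x (Fin.castAdd m j), x (Fin.natAdd m j)]) := by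
  intro Δ S hM m x
  obtain ⟨⟨htr, hrot⟩, hsc, hinv⟩ := hM
  refine ⟨fun v => ?_, fun A => ?_, fun c hc => ?_, fun hx0 => ?_⟩
  · -- translations carry no factor
    rw [htr (m + m) v x]
    simp only [covQuot_twoPoint_translate htr]
  · -- linear isometries carry no factor
    rw [hrot (m + m) A x]
    simp only [covQuot_twoPoint_rotate hrot]
  · -- dilations: the factor `c^{-2mΔ} = (c^{-2Δ})^m` cancels
    rw [hsc (m + m) c hc x]
    simp only [covQuot_twoPoint_smul hsc hc, Finset.prod_mul_distrib, Finset.prod_const,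
      Finset.card_univ, Fintype.card_fin, covQuot_rpow_pow hc]
    exact mul_div_mul_left _ _ (Real.rpow_pos_of_pos hc _).ne'
  · -- the unit inversion: the weight `∏ᵢ ‖xᵢ‖^{2Δ}` cancels
    rw [hinv (m + m) x hx0]
    have hden : (∏ j : Fin m, S 2 ![EuclideanGeometry.inversion 0 1 (x (Fin.castAdd m j)),
        EuclideanGeometry.inversion 0 1 (x (Fin.natAdd m j))]) =
        (∏ i : Fin (m + m), ‖x i‖ ^ (2 * Δ)) * ∏ j : Fin m, S 2 ![x (Fin.castAdd m j), x (Fin.natAdd m j)] := by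
      rw [← prod_pair_norms', ← Finset.prod_mul_distrib]
      exact Finset.prod_congr rfl fun j _ => covQuot_twoPoint_invert hinv (hx0 _) (hx0 _)
    rw [hden]
    exact mul_div_mul_left _ _
      (Finset.prod_ne_zero_iff.2 fun i _ => (Real.rpow_pos_of_pos (norm_pos_iff.2 (hx0 i)) _).ne')

end Summit.CriticalPhenomena.Ising3DConformalLimit.Cruxes.SpinRatioMoebius.Birth

end
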